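import Summits.BirchSwinnertonDyer.Rank1Residual.X5.SelmerSolitaireRebase
import Summits.BirchSwinnertonDyer.Rank1Residual.X5.SelmerSolitairePivotUnique
import Summits.BirchSwinnertonDyer.Rank1Residual.X5.SelmerSolitaireExtendVec
import HarnessLib

/-!
# Selmer solitaire: the pivot of a one-vertex extension is a one-vertex extension of the pivot (R2)

Cell `b2b-bsdres`, O1 (p = 2) PROVER ORDER v2.8 (ii′) (x11b3-p4; item (R2) of
`HOME/b2b-bsdres-x11b3-p4/T4PRIME-PLAN.md`, the input that lets T4′ pull a T4-move made on a RE-BASED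
position back to a move on the original position).  Pure 𝔽₂ linear algebra; theorems only; reach-neutral;
nothing booked; O1 OPEN.

For a position `P`, a core vertex `X` (`A = X⁺`), and a new row `μ` (a MOVE on `P`), put
`w := μ·𝟙_A` and **`ν := μ·𝟙_{Aᶜ} + (Ŝ ∗ A) w`** (the transformed row).  Then
`pivotPos (extend P μ) (lift X) = extend (pivotPos P X) ν`: re-basing commutes with moves up to this
change of the new row (Tucker's PPT of a bordered matrix).  Proof: the right-hand side satisfies the
exchange relation of the left-hand side (`eq_pivot_of_exchange`), by the exchange relation of `Ŝ ∗ A`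
on old rows and, on the new row, by the symmetry of `Ŝ ∗ A` and the vanishing of its quadratic form
(x11b3-p2's `Alt.dotProduct_mulVec_self_eq_zero`).

* `plus_lift_eq_image` — `(lift X)⁺ = oldV '' X⁺`; `core_extend_lift_iff` — old cores persist.
* `pivotPos_extend` — THE COMMUTATION (R2).

[cite: Tsatsomeros2000, Thm. 3.1] [cite: MazurRubin2004, §4.3]
-/

namespace Summit.BirchSwinnertonDyer.Rank1Residual.X5.SelmerSolitaire

open Finset Matrix

variable {s : ℕ}

/-- A position is determined by its adjacency matrix. [folklore] -/
theorem Position.eq_of_S_eq {P Q : Position s} (h : P.S = Q.S) : P = Q := by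
  cases P; cases Q; cases h; rfl

/-- **`(lift X)⁺ = oldV '' X⁺`.** [folklore] -/
theorem plus_lift_eq_image (X : Finset (Fin s)) : plus (lift X) = (plus X).image oldV := by
  ext v
  rw [Finset.mem_image]
  have hcard : (lift X).card = X.card := by unfold lift; exact Finset.card_map _
  constructor
  · intro hv
    cases v with
    | none =>
      refine ⟨none, ?_, rfl⟩
      have h := (none_mem_plus_iff (lift X)).mp hv
      rw [hcard] at h
      exact (none_mem_plus_iff X).mpr h
    | some j =>
      have hj := (some_mem_plus_iff (lift X) j).mp hv
      unfold lift at hj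
      obtain ⟨i, hi, rfl⟩ := Finset.mem_map.mp hj
      exact ⟨some i, (some_mem_plus_iff X i).mpr hi, rfl⟩
  · rintro ⟨u, hu, rfl⟩
    cases u with
    | none =>
      have h := (none_mem_plus_iff X).mp hu
      show (none : V (s + 1)) ∈ plus (lift X)
      rw [none_mem_plus_iff, hcard]; exact h
    | some i =>
      have hi := (some_mem_plus_iff X i).mp hu
      show (some i.castSucc : V (s + 1)) ∈ plus (lift X)
      rw [some_mem_plus_iff]
      unfold lift
      exact Finset.mem_map.mpr ⟨i, hi, rfl⟩

/-- **Old cores persist under a move**: `lift X` is core in `extend P μ` iff `X` is core in `P`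
(x11b3-p2's `det_extend_image_oldV`). [cite: MazurRubin2004, §4.3] -/
theorem core_extend_lift_iff (P : Position s) (μ : V s → ZMod 2) (X : Finset (Fin s)) :
    Core (extend P μ) (lift X) ↔ Core P X := by
  unfold Core
  rw [show (fun x : ↥(plus (lift X)) => (x : V (s + 1))) = Subtype.val from rfl,
    show (fun x : ↥(plus X) => (x : V s)) = Subtype.val from rfl,
    det_submatrix_congr (extend P μ).S (plus_lift_eq_image X)]
  show ((extend P μ).S.submatrix (Subtype.val : ↥((plus X).image oldV) → V (s + 1)) Subtype.val).det = 1 ↔ _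
  rw [det_extend_image_oldV]

/-- Membership of an old vertex in `(lift X)⁺`. [folklore] -/
theorem oldV_mem_plus_lift_iff (X : Finset (Fin s)) (v : V s) :
    oldV v ∈ plus (lift X) ↔ v ∈ plus X := by
  rw [plus_lift_eq_image, Finset.mem_image]
  constructor
  · rintro ⟨u, hu, huv⟩
    rwa [← oldV_injective huv]
  · intro hv
    exact ⟨v, hv, rfl⟩

/-- The new vertex is not in `(lift X)⁺`. [folklore] -/
theorem new_not_mem_plus_lift (X : Finset (Fin s)) : (some (Fin.last s) : V (s + 1)) ∉ plus (lift X) := by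
  rw [plus_lift_eq_image, Finset.mem_image]
  rintro ⟨u, -, hu⟩
  exact oldV_ne_new u hu

/-- Every vertex of the extended graph is an old vertex or the new one. [folklore] -/
theorem eq_oldV_or_new (u : V (s + 1)) : (∃ v : V s, u = oldV v) ∨ u = some (Fin.last s) := by
  rcases h : unNew u with _ | v
  · right
    have : unNew u = unNew (some (Fin.last s) : V (s + 1)) := by rw [h, unNew_new]
    exact unNew.injective this
  · exact Or.inl ⟨v, unNew_eq_some_iff.mp h⟩

/-- **(R2) The pivot of an extension is an extension of the pivot.**  With `A = X⁺`, `w = μ·𝟙_A` and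
`ν = μ·𝟙_{Aᶜ} + (Ŝ ∗ A) w`: `pivotPos (extend P μ) (lift X) = extend (pivotPos P X) ν`.
[cite: Tsatsomeros2000, Thm. 3.1] -/
theorem pivotPos_extend (P : Position s) (X : Finset (Fin s)) (hX : Core P X) (μ : V s → ZMod 2)
    (hX' : Core (extend P μ) (lift X)) :
    pivotPos (extend P μ) (lift X) hX' =
      extend (pivotPos P X hX)
        (fun v => (plus X).piecewise 0 μ v + (pivot P.S (plus X) *ᵥ (plus X).piecewise μ 0) v) := by
  classical
  set A : Finset (V s) := plus X with hAdef
  set w : V s → ZMod 2 := A.piecewise μ 0 with hw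
  set ν : V s → ZMod 2 := fun v => A.piecewise 0 μ v + (pivot P.S A *ᵥ w) v with hν
  have hA : IsUnit (P.S.submatrix (Subtype.val : ↥A → V s) Subtype.val).det := isUnit_det_of_core P X hX
  have hA' : IsUnit ((extend P μ).S.submatrix (Subtype.val : ↥(plus (lift X)) → V (s + 1)) Subtype.val).det :=
    isUnit_det_of_core (extend P μ) (lift X) hX'
  -- the pivot matrix is a position matrix: symmetric with zero diagonal, so its quadratic form vanishes
  have hQsymm : (pivot P.S A).IsSymm := pivot_isSymm P A
  have hQdiag : ∀ v, pivot P.S A v v = 0 := pivot_apply_self P A hA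
  apply Position.eq_of_S_eq
  show pivot (extend P μ).S (plus (lift X)) = (extend (pivotPos P X hX) ν).S
  symm
  refine eq_pivot_of_exchange hA' _ fun x' => ?_
  -- decode `x'` into its old part `x` and its new coordinate `t`
  set x : V s → ZMod 2 := fun v => x' (oldV v) with hx
  set t : ZMod 2 := x' (some (Fin.last s)) with ht
  -- the argument vector `y' = A'.piecewise (M'x') x'` on old vertices and at `q`
  have hy_old : ∀ v : V s, (plus (lift X)).piecewise ((extend P μ).S *ᵥ x') x' (oldV v) =
      A.piecewise (P.S *ᵥ x) x v + t * w v := by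
    intro v
    by_cases hv : v ∈ A
    · rw [Finset.piecewise_eq_of_mem _ _ _ ((oldV_mem_plus_lift_iff X v).mpr hv),
        Finset.piecewise_eq_of_mem _ _ _ hv, extend_mulVec_oldV, hw, Finset.piecewise_eq_of_mem _ _ _ hv]
      ring
    · rw [Finset.piecewise_eq_of_notMem _ _ _ (fun h => hv ((oldV_mem_plus_lift_iff X v).mp h)),
        Finset.piecewise_eq_of_notMem _ _ _ hv, hw, Finset.piecewise_eq_of_notMem _ _ _ hv]
      simp [hx]
  have hy_new : (plus (lift X)).piecewise ((extend P μ).S *ᵥ x') x' (some (Fin.last s)) = t :=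
    Finset.piecewise_eq_of_notMem _ _ _ (new_not_mem_plus_lift X)
  -- old part of `y'` as a vector
  have hy_vec : (fun v => (plus (lift X)).piecewise ((extend P μ).S *ᵥ x') x' (oldV v)) =
      A.piecewise (P.S *ᵥ x) x + t • w := by
    funext v; rw [hy_old]; simp [Pi.add_apply, Pi.smul_apply, smul_eq_mul]
  -- the exchange relation of `Ŝ ∗ A` and the transformed row
  have hexch : pivot P.S A *ᵥ A.piecewise (P.S *ᵥ x) x = A.piecewise x (P.S *ᵥ x) :=
    pivot_mulVec_piecewise hA x
  funext u
  rcases eq_oldV_or_new u with ⟨v, rfl⟩ | rfl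
  · -- an old row
    rw [extend_mulVec_oldV, hy_new]
    change (pivot P.S A *ᵥ fun v => (plus (lift X)).piecewise ((extend P μ).S *ᵥ x') x' (oldV v)) v +
      ν v * t = _
    rw [hy_vec, Matrix.mulVec_add, Matrix.mulVec_smul, hexch]
    simp only [Pi.add_apply, Pi.smul_apply, smul_eq_mul]
    by_cases hv : v ∈ A
    · rw [Finset.piecewise_eq_of_mem _ _ _ ((oldV_mem_plus_lift_iff X v).mpr hv),
        Finset.piecewise_eq_of_mem _ _ _ hv, hν]
      simp only [Finset.piecewise_eq_of_mem _ _ _ hv, Pi.zero_apply, zero_add]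
      -- `x v + t·(Qw)v + (Qw)v·t = x v`
      have : t * (pivot P.S A *ᵥ w) v + (pivot P.S A *ᵥ w) v * t = 0 := by
        rw [mul_comm]; exact CharTwo.add_self_eq_zero _
      have hxv : x v = x' (oldV v) := rfl
      linear_combination this + hxv
    · rw [Finset.piecewise_eq_of_notMem _ _ _ (fun h => hv ((oldV_mem_plus_lift_iff X v).mp h)),
        Finset.piecewise_eq_of_notMem _ _ _ hv, hν, extend_mulVec_oldV]
      simp only [Finset.piecewise_eq_of_notMem _ _ _ hv]
      have : t * (pivot P.S A *ᵥ w) v + (pivot P.S A *ᵥ w) v * t = 0 := by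
        rw [mul_comm]; exact CharTwo.add_self_eq_zero _
      rw [← ht]
      linear_combination (exp := 1) this
  · -- the new row: `ν ⬝ y = μ ⬝ x`
    rw [extend_mulVec_new, Finset.piecewise_eq_of_notMem _ _ _ (new_not_mem_plus_lift X),
      extend_mulVec_new]
    simp_rw [hy_old]
    -- `∑ ν v (z v + t w v) = ∑ μ v x v` with `z = A.piecewise (Sx) x`
    have hνw : ∑ v : V s, ν v * w v = 0 := by
      have h0 := Alt.dotProduct_mulVec_self_eq_zero (pivot P.S A) hQsymm hQdiag w
      simp only [dotProduct] at h0
      rw [← h0]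
      refine Finset.sum_congr rfl fun v _ => ?_
      rw [hν]
      by_cases hv : v ∈ A
      · simp only [Finset.piecewise_eq_of_mem _ _ _ hv, Pi.zero_apply, zero_add]; ring
      · simp only [hw, Finset.piecewise_eq_of_notMem _ _ _ hv, Pi.zero_apply, mul_zero, zero_mul]
    have hνz : ∑ v : V s, ν v * A.piecewise (P.S *ᵥ x) x v = ∑ v : V s, μ v * x v := by
      -- `ν ⬝ z = (μ𝟙_{Aᶜ}) ⬝ z + (Q w) ⬝ z` and `(Q w) ⬝ z = w ⬝ (Q z) = w ⬝ (A.piecewise x (Sx))`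
      have h1 : (fun v => (pivot P.S A *ᵥ w) v) ⬝ᵥ A.piecewise (P.S *ᵥ x) x =
          w ⬝ᵥ (pivot P.S A *ᵥ A.piecewise (P.S *ᵥ x) x) := by
        rw [Matrix.dotProduct_mulVec, ← Matrix.mulVec_transpose, hQsymm.eq, dotProduct_comm]
      rw [hexch] at h1
      simp only [dotProduct] at h1
      calc ∑ v : V s, ν v * A.piecewise (P.S *ᵥ x) x v
          = ∑ v : V s, (A.piecewise 0 μ v * A.piecewise (P.S *ᵥ x) x v +
              (pivot P.S A *ᵥ w) v * A.piecewise (P.S *ᵥ x) x v) := by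
            refine Finset.sum_congr rfl fun v _ => ?_; rw [hν]; ring
        _ = ∑ v : V s, A.piecewise 0 μ v * A.piecewise (P.S *ᵥ x) x v +
              ∑ v : V s, w v * A.piecewise x (P.S *ᵥ x) v := by
            rw [Finset.sum_add_distrib, h1]
        _ = ∑ v : V s, μ v * x v := by
            rw [← Finset.sum_add_distrib]
            refine Finset.sum_congr rfl fun v _ => ?_
            by_cases hv : v ∈ A
            · simp [hw, Finset.piecewise_eq_of_mem _ _ _ hv]
            · simp [hw, Finset.piecewise_eq_of_notMem _ _ _ hv]
    calc ∑ v : V s, ν v * (A.piecewise (P.S *ᵥ x) x v + t * w v)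
        = ∑ v : V s, ν v * A.piecewise (P.S *ᵥ x) x v + t * ∑ v : V s, ν v * w v := by
          rw [Finset.mul_sum, ← Finset.sum_add_distrib]
          refine Finset.sum_congr rfl fun v _ => by ring
      _ = ∑ v : V s, μ v * x v := by rw [hνw, mul_zero, add_zero, hνz]
      _ = ∑ v : V s, μ v * x' (oldV v) := rfl

end Summit.BirchSwinnertonDyer.Rank1Residual.X5.SelmerSolitaire
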